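import Mathlib
import Summits.Ventures.PercRepro2.Defs
import Summits.Ventures.PercRepro2.Graph
import Summits.Ventures.PercRepro2.Harris
import Summits.Ventures.PercRepro2.Events
import Summits.Ventures.PercRepro2.Independence
import Summits.Ventures.PercRepro2.Induced
import Summits.Ventures.PercRepro2.Exploration
import Summits.Ventures.PercRepro2.GateDefs
import Summits.Ventures.PercRepro2.GateAnatomy
import Summits.Ventures.PercRepro2.GateForest
import Summits.Ventures.PercRepro2.GateLSM
import Summits.Ventures.PercRepro2.HullTree
import Summits.Ventures.PercRepro2.GateFeedbackForest
import Summits.Ventures.PercRepro2.GateFeedback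
import Summits.Ventures.PercRepro2.GateFeedbackExit
import Summits.Ventures.PercRepro2.GateContract
import Summits.Ventures.PercRepro2.GateShadow

import Summits.Ventures.PercRepro2.GateSide
/-!
# Separator reductions of the class-B mass: the exit and the avoided vertex can be moved to
a cut vertex (blind cell PercRepro2, mine-c g10; proofs/MINEC-FEEDBACK.md §11)

Lens «reveal the status of a cut vertex». In every graph the class-B mass of the free one-sided
gate factorises as
  `massB W = 1[t,u,w ∉ W] · P(C(s) = W) · P(t ↔ w in G ∖ W)`      (`massB_eq_connDel`)
(the domain Markov identity `prob_clusterEvent_inter_connEvent_eq_mul_connDel`), which is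
SYMMETRIC in the avoided vertex `t` and the exit vertex `w` (`massB_comm`).

Let `z` SEPARATE `w` from `t` (every `w–t` path passes through `z`: `w ∉ side z t`) and let the
root not lie on `w`'s side (`w ∉ side z s`). Then every root cluster of positive class-B mass lies
on the side of `s`, the connection `t ↔ w` in `G ∖ W` splits as `t ↔ z` in `G ∖ W` and `z ↔ w`
(the latter untouched by `W`, independent of the former), and
  `massB (s,t,u,w) = P(z ↔ w) · massB (s,t,u,z)`      (`massB_eq_mul_of_sep`).
Hence the FKG lattice condition transfers: **the exit can be moved to `z`**
(`massBLogSupermod_of_sep_exit`), and by the symmetry **the avoided vertex can be moved to a cut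
vertex `z` separating `t` from `w` when the root is not on `t`'s side**
(`massBLogSupermod_of_sep_avoid`). The gate follows from the lattice condition of the reduced
instance (`gateRow_of_sep_exit`, `gateRow_of_sep_avoid`, `gateRow_of_sep_two`); with the forest
theorems of g9 as base cases this gives e.g. `gateRow_of_sep_exit_of_isForest_del_exit`: every
cycle of `G` passes through a cut vertex `z` separating the exit from the avoided vertex, the root
not beyond `z` ⟹ the free gate (the root may sit on a cycle through `z`, which no earlier class
allows).
-/


namespace Summit.Ventures.PercRepro2

namespace GateSep

open GateSide

open scoped Classical

variable {V : Type*} {E : Type*} [Fintype E] [Fintype V]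
variable {R : Type*} [Field R] [LinearOrder R] [IsStrictOrderedRing R]

/-! ## The class-B mass factorises in every graph -/

omit [LinearOrder R] [IsStrictOrderedRing R] in
/-- **The class-B mass in every graph**: `massB W = 1[t,u,w ∉ W] · P(C(s) = W) · P(t ↔ w in G ∖ W)`. -/
theorem massB_eq_connDel (p : E → R) (ends : E → Sym2 V) (s t u w : V) (W : Finset V) :
    GateLSM.massB p ends s t u w W =
      if t ∈ W ∨ u ∈ W ∨ w ∈ W then 0 else
        prob p (clusterEvent ends s (↑W : Set V)) * prob p (connDelEvent ends W t w) := by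
  unfold GateLSM.massB
  split_ifs with h
  · rw [show clusterEvent ends s (↑W : Set V) ∩ GateAnatomy.classB ends s t u w = ∅ from ?_, prob_empty]
    ext ω
    simp only [Set.mem_inter_iff, GateAnatomy.classB, mem_clusterInEvent, Set.mem_setOf_eq,
      avoidAll, Set.mem_empty_iff_false, iff_false, not_and, mem_clusterEvent]
    intro hW hcw hav
    have hmem : ∀ v ∈ W, Conn ends ω s v := fun v hv => by
      have : v ∈ cluster ends ω s := by rw [hW]; exact Finset.mem_coe.2 hv
      exact this
    rcases h with h | h | h
    · exact hav t (by simp) (hmem t h)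
    · exact hav u (by simp) (hmem u h)
    · exact hav t (by simp) ((hmem w h).trans (conn_symm hcw))
  · simp only [not_or] at h
    obtain ⟨ht, hu, hwW⟩ := h
    have hset : clusterEvent ends s (↑W : Set V) ∩ GateAnatomy.classB ends s t u w =
        clusterEvent ends s (↑W : Set V) ∩ connEvent ends t w := by
      ext ω
      simp only [Set.mem_inter_iff, GateAnatomy.classB, mem_clusterInEvent, Set.mem_setOf_eq,
        avoidAll, mem_clusterEvent, connEvent]
      constructor
      · rintro ⟨hW, hcw, _⟩; exact ⟨hW, hcw⟩
      · rintro ⟨hW, hcw⟩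
        refine ⟨hW, hcw, fun v hv hc => ?_⟩
        have : v ∈ cluster ends ω s := hc
        rw [hW] at this
        simp only [Finset.mem_union, Finset.mem_singleton] at hv
        rcases hv with rfl | rfl
        · exact ht (Finset.mem_coe.1 this)
        · exact hu (Finset.mem_coe.1 this)
    rw [hset]
    exact prob_clusterEvent_inter_connEvent_eq_mul_connDel p ends s W ht

omit [Fintype E] in
/-- `{t ↔ w in G ∖ W} = {w ↔ t in G ∖ W}`. -/
lemma connDelEvent_comm (ends : E → Sym2 V) (W : Finset V) (t w : V) :
    connDelEvent ends W t w = connDelEvent ends W w t := by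
  ext ω
  exact ⟨conn_symm, conn_symm⟩

omit [LinearOrder R] [IsStrictOrderedRing R] in
/-- **The class-B mass is symmetric in the avoided vertex and the exit vertex.** -/
theorem massB_comm (p : E → R) (ends : E → Sym2 V) (s t u w : V) :
    GateLSM.massB p ends s t u w = GateLSM.massB p ends s w u t := by
  funext W
  rw [massB_eq_connDel, massB_eq_connDel, connDelEvent_comm]
  by_cases h : t ∈ W ∨ u ∈ W ∨ w ∈ W
  · rw [if_pos h, if_pos (by tauto)]
  · rw [if_neg h, if_neg (by tauto)]

omit [IsStrictOrderedRing R] in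
/-- The FKG lattice condition is symmetric in the avoided vertex and the exit vertex. -/
theorem massBLogSupermod_comm {p : E → R} {ends : E → Sym2 V} {s t u w : V}
    (h : GateLSM.MassBLogSupermod p ends s t u w) : GateLSM.MassBLogSupermod p ends s w u t := by
  intro W₁ W₂
  rw [← massB_comm]
  exact h W₁ W₂

/-! ## The reduction -/

section Reduction

variable {ends : E → Sym2 V}

omit [Fintype E] [Fintype V] in
/-- A root cluster not containing `z` lies on the side of the root. -/
lemma subset_side_of_clusterEvent {s z : V} {W : Finset V} (hz : z ∉ W) {ω : Config E}
    (hω : ω ∈ clusterEvent ends s (↑W : Set V)) {v : V} (hv : v ∈ W) : v ∈ side ends z s := by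
  by_contra hn
  have hc : Conn ends ω s v := by
    have : v ∈ cluster ends ω s := by rw [mem_clusterEvent.1 hω]; exact Finset.mem_coe.2 hv
    exact this
  obtain ⟨t, ht, hst⟩ := GateShadow.exists_conn_mem_of_not_reachDel (T := {z}) hc hn
  rw [Finset.mem_singleton] at ht
  subst ht
  have : t ∈ cluster ends ω s := hst
  rw [mem_clusterEvent.1 hω] at this
  exact hz (Finset.mem_coe.1 this)

omit [LinearOrder R] [IsStrictOrderedRing R] in
/-- **THE SEPARATOR REDUCTION.** If `z` separates the exit `w` from the avoided vertex `t` and the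
root is not on `w`'s side, then `massB (s,t,u,w) W = P(z ↔ w) · massB (s,t,u,z) W` for every `W`. -/
theorem massB_eq_mul_of_sep (p : E → R) {s t u w z : V} (hsep : w ∉ side ends z t)
    (hside : w ∉ side ends z s) (hwz : w ≠ z) (htz : t ≠ z) (W : Finset V) :
    GateLSM.massB p ends s t u w W =
      prob p (connEvent ends z w) * GateLSM.massB p ends s t u z W := by
  rw [massB_eq_connDel, massB_eq_connDel]
  by_cases hz : z ∈ W
  · rw [if_pos (Or.inr (Or.inr hz)), mul_zero]
    split_ifs with h
    · rfl
    · simp only [not_or] at h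
      have : connDelEvent ends W t w = ∅ := by
        ext ω
        simp only [Set.mem_empty_iff_false, iff_false]
        intro hω
        have := ((mem_connDelEvent_iff_of_sep hsep W).1 hω).1
        exact not_conn_restrict_of_mem h.1 hz this
      rw [this, prob_empty, mul_zero]
  · by_cases hν : prob p (clusterEvent ends s (↑W : Set V)) = 0
    · rw [hν]
      simp
    · obtain ⟨ω₀, hω₀⟩ := GateFeedback.nonempty_of_prob_ne_zero hν
      have hWs : ∀ v ∈ W, v ∈ side ends z s := fun v hv => subset_side_of_clusterEvent hz hω₀ hv
      have hwW : w ∉ W := fun h => hside (hWs w h)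
      simp only [hwW, hz, or_false]
      split_ifs with h
      · rw [mul_zero]
      · have hWw : ∀ v ∈ W, v ∉ side ends z w := fun v hv hvw =>
          hside (mem_side_trans (hWs v hv) (mem_side_symm hvw))
        have key : prob p (connDelEvent ends W t w) =
            prob p (connDelEvent ends W t z) * prob p (connEvent ends z w) := by
          rw [← prob_connDelEvent_inter_connEvent_of_sep p htz hwz hsep W]
          congr 1
          ext ω
          rw [mem_connDelEvent_iff_of_sep hsep W, Set.mem_inter_iff,
            connDelEvent_eq_connEvent_of_side hwz hz hWw]
        rw [key]
        ring

/-- **The exit moves to a separator**: the FKG lattice condition for `(s,t,u,z)` gives it for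
`(s,t,u,w)` when `z` separates `w` from `t` and the root is not on `w`'s side. -/
theorem massBLogSupermod_of_sep_exit {p : E → R} (hp : IsProbVec p) {s t u w z : V}
    (hsep : w ∉ side ends z t) (hside : w ∉ side ends z s) (hwz : w ≠ z) (htz : t ≠ z)
    (h : GateLSM.MassBLogSupermod p ends s t u z) : GateLSM.MassBLogSupermod p ends s t u w := by
  intro W₁ W₂
  rw [massB_eq_mul_of_sep p hsep hside hwz htz W₁, massB_eq_mul_of_sep p hsep hside hwz htz W₂,
    massB_eq_mul_of_sep p hsep hside hwz htz (W₁ ∩ W₂),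
    massB_eq_mul_of_sep p hsep hside hwz htz (W₁ ∪ W₂)]
  have hc : 0 ≤ prob p (connEvent ends z w) := prob_nonneg hp _
  have := mul_le_mul_of_nonneg_left (h W₁ W₂) (mul_nonneg hc hc)
  calc prob p (connEvent ends z w) * GateLSM.massB p ends s t u z W₁ *
        (prob p (connEvent ends z w) * GateLSM.massB p ends s t u z W₂)
      = prob p (connEvent ends z w) * prob p (connEvent ends z w) *
        (GateLSM.massB p ends s t u z W₁ * GateLSM.massB p ends s t u z W₂) := by ring
    _ ≤ prob p (connEvent ends z w) * prob p (connEvent ends z w) *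
        (GateLSM.massB p ends s t u z (W₁ ∩ W₂) * GateLSM.massB p ends s t u z (W₁ ∪ W₂)) := this
    _ = _ := by ring

/-- **The avoided vertex moves to a separator**: the FKG lattice condition for `(s,z,u,w)` gives
it for `(s,t,u,w)` when `z` separates `t` from `w` and the root is not on `t`'s side. -/
theorem massBLogSupermod_of_sep_avoid {p : E → R} (hp : IsProbVec p) {s t u w z : V}
    (hsep : t ∉ side ends z w) (hside : t ∉ side ends z s) (htz : t ≠ z) (hwz : w ≠ z)
    (h : GateLSM.MassBLogSupermod p ends s z u w) : GateLSM.MassBLogSupermod p ends s t u w :=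
  massBLogSupermod_comm
    (massBLogSupermod_of_sep_exit hp hsep hside htz hwz (massBLogSupermod_comm h))

end Reduction

/-! ## The gate -/

section Gate

variable {ends : E → Sym2 V}

/-- The free one-sided gate from the FKG lattice condition (positivity-free form). -/
theorem gateRow_of_massBLogSupermod {p : E → R} (hp : IsProbVec p) (s t a b u w : V)
    (h : GateLSM.MassBLogSupermod p ends s t u w) : Gate.GateRow p ends s {t} a b {u} {w} :=
  GateForest.gateRow_of_covC_nonneg p ends s t a b u w hp
    (GateLSM.covC_classA_nonneg ends s t a b w hp)
    (GateLSM.covC_classB_nonneg ends s t a b u w hp h)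

/-- **The gate at `w` from the lattice condition at a separator `z`** (`z` separates `w` from
`t`, the root is not beyond `z`). -/
theorem gateRow_of_sep_exit {p : E → R} (hp : IsProbVec p) (s t a b u w z : V)
    (hsep : w ∉ side ends z t) (hside : w ∉ side ends z s) (hwz : w ≠ z) (htz : t ≠ z)
    (h : GateLSM.MassBLogSupermod p ends s t u z) : Gate.GateRow p ends s {t} a b {u} {w} :=
  gateRow_of_massBLogSupermod hp s t a b u w (massBLogSupermod_of_sep_exit hp hsep hside hwz htz h)

/-- **The gate at `t` from the lattice condition at a separator `z`** (`z` separates `t` from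
`w`, the root is not beyond `z`). -/
theorem gateRow_of_sep_avoid {p : E → R} (hp : IsProbVec p) (s t a b u w z : V)
    (hsep : t ∉ side ends z w) (hside : t ∉ side ends z s) (htz : t ≠ z) (hwz : w ≠ z)
    (h : GateLSM.MassBLogSupermod p ends s z u w) : Gate.GateRow p ends s {t} a b {u} {w} :=
  gateRow_of_massBLogSupermod hp s t a b u w (massBLogSupermod_of_sep_avoid hp hsep hside htz hwz h)

/-- **Two separators**: `z₁` separates `w` from `t` with the root not beyond `z₁`, and `z₂`
separates `t` from `z₁` with the root not beyond `z₂`; the lattice condition of the middle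
instance `(s, z₂, u, z₁)` gives the gate `(s, t, u, w)`. -/
theorem gateRow_of_sep_two {p : E → R} (hp : IsProbVec p) (s t a b u w z₁ z₂ : V)
    (hsep₁ : w ∉ side ends z₁ t) (hside₁ : w ∉ side ends z₁ s) (hwz₁ : w ≠ z₁) (htz₁ : t ≠ z₁)
    (hsep₂ : t ∉ side ends z₂ z₁) (hside₂ : t ∉ side ends z₂ s) (htz₂ : t ≠ z₂) (hz₁z₂ : z₁ ≠ z₂)
    (h : GateLSM.MassBLogSupermod p ends s z₂ u z₁) : Gate.GateRow p ends s {t} a b {u} {w} :=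
  gateRow_of_sep_exit hp s t a b u w z₁ hsep₁ hside₁ hwz₁ htz₁
    (massBLogSupermod_of_sep_avoid hp hsep₂ hside₂ htz₂ hz₁z₂ h)

/-- **Every cycle through the separator**: if `z` separates `w` from `t`, the root is not beyond
`z`, and `G − z` is a forest, the free gate holds (the root may lie on a cycle through `z`). -/
theorem gateRow_of_sep_exit_of_isForest_del_exit {p : E → R} (hp : IsProbVec p) (s t a b u w z : V)
    (hsep : w ∉ side ends z t) (hside : w ∉ side ends z s) (hwz : w ≠ z) (htz : t ≠ z)
    (hF : Hull.IsForest (GateFeedback.endsF ends z)) : Gate.GateRow p ends s {t} a b {u} {w} :=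
  gateRow_of_sep_exit hp s t a b u w z hsep hside hwz htz
    (GateFeedback.massBLogSupermod_of_isForest_del_exit hp hF htz.symm)

/-- **Every cycle through the separator, avoided side**: if `z` separates `t` from `w`, the root
is not beyond `z`, and `G − z` is a forest, the free gate holds. -/
theorem gateRow_of_sep_avoid_of_isForest_del {p : E → R} (hp : IsProbVec p) (s t a b u w z : V)
    (hsep : t ∉ side ends z w) (hside : t ∉ side ends z s) (htz : t ≠ z) (hwz : w ≠ z)
    (hF : Hull.IsForest (GateFeedback.endsF ends z)) : Gate.GateRow p ends s {t} a b {u} {w} :=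
  gateRow_of_sep_avoid hp s t a b u w z hsep hside htz hwz
    (GateFeedback.massBLogSupermod_of_isForest_del hp hF hwz)

end Gate

end GateSep

end Summit.Ventures.PercRepro2
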